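import Mathlib
import HarnessLib
import Summits.Ventures.LatticeQCDFlow.Exactness.NCMCGeneralSpaceDoeblinPowerDecorrelation

/-!
# An `m`-step Doeblin minorisation `(nHit κ m)(x, ·) ≥ ε ν` gives a GEOMETRIC sup-norm envelope:
# `|(kop κ)^[t] g − πg| ≤ 2 C_g A ρ^t` with `ρ = 1 − e/(m+1)`, `A = (ρ^m)⁻¹`

HONEST FRAMING: exact (Metropolis-corrected) sampling algorithms for lattice gauge theory;
figures of merit are autocorrelation/cost numbers at stated couplings and volumes; no
continuum-physics claim.

Venture `LatticeQCDFlow` (cell pub-lqcd), topic `Scoring`; FANOUT row 8 (`s0-cpn-nemc`, GEN-20).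
NEW WORK of the cell, not a published result; no definition is introduced; nothing is cited as a
fact.  The composite samplers of the cell (Metropolis / heat-bath sweeps, HMC trajectories, the
engine's NCMC lane) are certified by a minorisation of a POWER of their kernel,
`(nHit κ m)(x, ·) ≥ ε ν` for a probability law `ν` (`0 < ε ≤ 1`, `0 < m`; `e = ε.toReal`), under which
row 13 proved the STAIRCASE sup-norm bias `|(kop κ)^[t] g (x) − ∫ g dπ| ≤ 2 C_g (1 − e)^{⌊t/m⌋}`
(`Exactness.GeneralNCMC.abs_iterate_kop_sub_integral_le_of_nHit`).  Row 8's batch-means chain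
(`Scoring/GeometricEnvelopeDecorrelation.lean` … `Scoring/BatchMeansConsistencyEnvelope.lean`) consumes
a plain GEOMETRIC envelope `2 C_g A ρ^t`.  This file converts the one into the other by Bernoulli's
inequality, with no real exponents: for `ρ := 1 − e/(m+1)` one has `1 − e ≤ ρ^{m+1} ≤ ρ^m`
(`one_add_mul_le_pow`), hence with `t = m ⌊t/m⌋ + (t mod m)`:
`(1 − e)^{⌊t/m⌋} ≤ ρ^{m ⌊t/m⌋} = ρ^t / ρ^{t mod m} ≤ ρ^t / ρ^m`.  So EVERY Doeblin-power certificate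
yields the envelope with `ρ = 1 − e/(m+1) ∈ (0, 1)` and `A = (ρ^m)⁻¹ ≥ 1` (`1/(1 − ρ) = (m+1)/e`); the
one-step case is `m = 1` (`Exactness.GeneralNCMC.nHit_one`).  The batch-means corollaries under a
Doeblin power are `Scoring/DoeblinPowerBatchMeans.lean`.

## Content (`κ` Markov on `Ω`, `π` invariant, `(nHit κ m)(x, ·) ≥ ε ν`, `0 < ε ≤ 1`, `0 < m`)

* `doeblinPower_rate_pos`, `doeblinPower_rate_lt_one`, `one_sub_le_doeblinPower_rate_pow` —
  `ρ = 1 − e/(m+1)` satisfies `0 < ρ < 1` and `1 − e ≤ ρ^m`;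
  `pow_div_le_doeblinPower_rate_pow` — `(1 − e)^{⌊t/m⌋} ≤ (ρ^m)⁻¹ ρ^t`;
* **`geometricEnvelope_of_nHit`** — for every bounded measurable `g` (`|g| ≤ C_g`), every `t`, `x`:
  `|(kop κ)^[t] g x − ∫ g dπ| ≤ 2 C_g ((ρ^m)⁻¹ ρ^t)`;
* **`exists_geometricEnvelope_of_nHit`** — `∃ A ρ, 0 ≤ A ∧ 0 ≤ ρ ∧ ρ < 1 ∧ (envelope)`, the shape
  consumed by the `…_of_envelope` theorems of the row.

NOT CLAIMED: the optimal rate `(1 − e)^{1/m}`; anything about a concrete sampler.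
-/

noncomputable section

namespace Summit.Ventures.LatticeQCDFlow.Scoring

open MeasureTheory ProbabilityTheory Filter Finset Preorder Literature.Probability.MarkovChains
open scoped ENNReal Topology

variable {Ω : Type*} [MeasurableSpace Ω]

/-! ### The rate `ρ = 1 − e/(m+1)` (real arithmetic) -/

section Rate

/-- `0 < 1 − e/(m+1)` for `e ≤ 1` and `0 < m`. -/
theorem doeblinPower_rate_pos {e : ℝ} (he1 : e ≤ 1) {m : ℕ} (hm : 0 < m) :
    0 < 1 - e / ((m : ℝ) + 1) := by
  have hm1 : (1 : ℝ) ≤ (m : ℝ) := Nat.one_le_cast.2 hm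
  have hm0 : (0 : ℝ) < (m : ℝ) + 1 := by linarith
  rw [sub_pos, div_lt_one hm0]
  linarith

/-- `1 − e/(m+1) < 1` for `0 < e`. -/
theorem doeblinPower_rate_lt_one {e : ℝ} (he0 : 0 < e) (m : ℕ) :
    1 - e / ((m : ℝ) + 1) < 1 := by
  have hm0 : (0 : ℝ) < (m : ℝ) + 1 := by linarith [(Nat.cast_nonneg m : (0 : ℝ) ≤ m)]
  linarith [div_pos he0 hm0]

/-- **Bernoulli**: `1 − e ≤ (1 − e/(m+1))^m` for `0 ≤ e ≤ 1`, `0 < m`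
(`1 − e = 1 + (m+1)(−e/(m+1)) ≤ (1 − e/(m+1))^{m+1} ≤ (1 − e/(m+1))^m`). -/
theorem one_sub_le_doeblinPower_rate_pow {e : ℝ} (he0 : 0 ≤ e) (he1 : e ≤ 1) {m : ℕ} (hm : 0 < m) :
    1 - e ≤ (1 - e / ((m : ℝ) + 1)) ^ m := by
  have hm0 : (0 : ℝ) < (m : ℝ) + 1 := by linarith [(Nat.cast_nonneg m : (0 : ℝ) ≤ m)]
  have hρ0 : 0 < 1 - e / ((m : ℝ) + 1) := doeblinPower_rate_pos he1 hm
  have hρ1 : 1 - e / ((m : ℝ) + 1) ≤ 1 := by linarith [div_nonneg he0 hm0.le]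
  have ha : (-2 : ℝ) ≤ -(e / ((m : ℝ) + 1)) := by
    have : e / ((m : ℝ) + 1) ≤ 1 := by rw [div_le_one hm0]; linarith
    linarith
  have hB := one_add_mul_le_pow ha (m + 1)
  have hlhs : (1 : ℝ) + ((m + 1 : ℕ) : ℝ) * -(e / ((m : ℝ) + 1)) = 1 - e := by
    push_cast
    field_simp
    ring
  rw [hlhs, ← sub_eq_add_neg] at hB
  exact hB.trans (pow_le_pow_of_le_one hρ0.le hρ1 (Nat.le_succ m))

/-- **The staircase is below a geometric sequence**: for `0 ≤ e ≤ 1`, `0 < m`, `ρ = 1 − e/(m+1)`: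
`(1 − e)^{⌊t/m⌋} ≤ (ρ^m)⁻¹ ρ^t` for every `t`. -/
theorem pow_div_le_doeblinPower_rate_pow {e : ℝ} (he0 : 0 ≤ e) (he1 : e ≤ 1) {m : ℕ} (hm : 0 < m)
    (t : ℕ) :
    (1 - e) ^ (t / m) ≤ ((1 - e / ((m : ℝ) + 1)) ^ m)⁻¹ * (1 - e / ((m : ℝ) + 1)) ^ t := by
  have hm0 : (0 : ℝ) < (m : ℝ) + 1 := by linarith [(Nat.cast_nonneg m : (0 : ℝ) ≤ m)]
  set ρ : ℝ := 1 - e / ((m : ℝ) + 1) with hρ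
  have hρ0 : 0 < ρ := doeblinPower_rate_pos he1 hm
  have hρ1 : ρ ≤ 1 := by rw [hρ]; linarith [div_nonneg he0 hm0.le]
  have h1e : 0 ≤ 1 - e := sub_nonneg.2 he1
  -- `(1 − e)^q ≤ ρ^{m q}`
  have hq : (1 - e) ^ (t / m) ≤ ρ ^ (m * (t / m)) := by
    rw [pow_mul]
    exact pow_le_pow_left₀ h1e (one_sub_le_doeblinPower_rate_pow he0 he1 hm) _
  -- `ρ^{m q} ρ^m ≤ ρ^{m q} ρ^{t mod m} = ρ^t`
  have hsplit : ρ ^ t = ρ ^ (m * (t / m)) * ρ ^ (t % m) := by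
    rw [← pow_add, Nat.div_add_mod]
  have hmod : ρ ^ m ≤ ρ ^ (t % m) := pow_le_pow_of_le_one hρ0.le hρ1 (Nat.mod_lt t hm).le
  have hρm0 : 0 < ρ ^ m := pow_pos hρ0 m
  calc (1 - e) ^ (t / m) ≤ ρ ^ (m * (t / m)) := hq
    _ = (ρ ^ m)⁻¹ * (ρ ^ (m * (t / m)) * ρ ^ m) := by field_simp
    _ ≤ (ρ ^ m)⁻¹ * (ρ ^ (m * (t / m)) * ρ ^ (t % m)) :=
        mul_le_mul_of_nonneg_left (mul_le_mul_of_nonneg_left hmod (pow_nonneg hρ0.le _))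
          (inv_nonneg.2 hρm0.le)
    _ = (ρ ^ m)⁻¹ * ρ ^ t := by rw [← hsplit]

end Rate

/-! ### The envelope from an `m`-step minorisation -/

section Power

variable {κ : Kernel Ω Ω} [IsMarkovKernel κ] {ν : Measure Ω} [IsProbabilityMeasure ν] {ε : ℝ≥0∞}
  {π : Measure Ω} [IsProbabilityMeasure π] {m : ℕ}

/-- **THE GEOMETRIC SUP-NORM ENVELOPE OF A DOEBLIN POWER.**  If `(nHit κ m)(x, ·) ≥ ε ν`
(`ε ≤ 1`, `0 < m`, `e = ε.toReal`) and `π` is invariant, then for EVERY bounded measurable `g`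
(`|g| ≤ C_g`), every `t` and every `x`, with `ρ = 1 − e/(m+1)`:
`|(kop κ)^[t] g x − ∫ g dπ| ≤ 2 C_g ((ρ^m)⁻¹ ρ^t)`. -/
theorem geometricEnvelope_of_nHit
    (hmin : ∀ x {B : Set Ω}, MeasurableSet B → ε * ν B ≤ Exactness.nHit κ m x B)
    (hε1 : ε ≤ 1) (hm : 0 < m) (hπ : Kernel.Invariant κ π)
    {g : Ω → ℝ} (hg : Measurable g) {Cg : ℝ} (hCg : ∀ x, |g x| ≤ Cg) (t : ℕ) (x : Ω) :
    |(kop κ)^[t] g x - ∫ y, g y ∂π|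
      ≤ 2 * Cg * (((1 - ε.toReal / ((m : ℝ) + 1)) ^ m)⁻¹ * (1 - ε.toReal / ((m : ℝ) + 1)) ^ t) := by
  have he0 : 0 ≤ ε.toReal := ENNReal.toReal_nonneg
  have he1 : ε.toReal ≤ 1 := ENNReal.toReal_le_of_le_ofReal zero_le_one (by simpa using hε1)
  have hCg0 : 0 ≤ Cg := (abs_nonneg _).trans (hCg x)
  have h0 := Exactness.GeneralNCMC.abs_iterate_kop_sub_integral_le_of_nHit hmin hε1 hπ hg hCg t x
  exact h0.trans (mul_le_mul_of_nonneg_left (pow_div_le_doeblinPower_rate_pow he0 he1 hm t)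
    (by positivity))

/-- **Existential packaging**: an `m`-step Doeblin certificate (`0 < ε ≤ 1`, `0 < m`, `π` invariant)
yields constants `A ≥ 0`, `0 ≤ ρ < 1` with `|(kop κ)^[t] g x − ∫ g dπ| ≤ 2 C_g (A ρ^t)` for every
bounded measurable `g`, every `t`, `x` — the hypothesis of the row's `…_of_envelope` theorems. -/
theorem exists_geometricEnvelope_of_nHit
    (hmin : ∀ x {B : Set Ω}, MeasurableSet B → ε * ν B ≤ Exactness.nHit κ m x B) (hε0 : 0 < ε)
    (hε1 : ε ≤ 1) (hm : 0 < m) (hπ : Kernel.Invariant κ π) :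
    ∃ A ρ : ℝ, 0 ≤ A ∧ 0 ≤ ρ ∧ ρ < 1 ∧
      ∀ (g : Ω → ℝ), Measurable g → ∀ (Cg : ℝ), (∀ x, |g x| ≤ Cg) →
        ∀ (t : ℕ) (x : Ω), |(kop κ)^[t] g x - ∫ y, g y ∂π| ≤ 2 * Cg * (A * ρ ^ t) := by
  have hεtop : ε ≠ ∞ := ne_top_of_le_ne_top ENNReal.one_ne_top hε1
  have he0 : 0 < ε.toReal := ENNReal.toReal_pos hε0.ne' hεtop
  have he1 : ε.toReal ≤ 1 := ENNReal.toReal_le_of_le_ofReal zero_le_one (by simpa using hε1)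
  have hρ0 : 0 < 1 - ε.toReal / ((m : ℝ) + 1) := doeblinPower_rate_pos he1 hm
  refine ⟨((1 - ε.toReal / ((m : ℝ) + 1)) ^ m)⁻¹, 1 - ε.toReal / ((m : ℝ) + 1),
    inv_nonneg.2 (pow_nonneg hρ0.le m), hρ0.le, doeblinPower_rate_lt_one he0 m, ?_⟩
  intro g hg Cg hCg t x
  exact geometricEnvelope_of_nHit hmin hε1 hm hπ hg hCg t x

end Power

end Summit.Ventures.LatticeQCDFlow.Scoring

end
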